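import Literature.Geometry.Symplectic.SteinSmoothMax
import Literature.Geometry.Symplectic.SteinLevelTransport
import Literature.Geometry.Symplectic.SteinJBundle
import HarnessLib

/-!
# `J`-convexity is an open condition, stable under `C²`-small perturbations on compact sets

Topic `Literature/Geometry/Symplectic`; proofs file of the fact seat of
`Literature.Geometry.Symplectic.Gompf1998_thm13_twoHandles` (**E2**, `SteinTwoHandles.lean`).
Every gluing of `J`-convex functions (cut-offs, interpolations, smooth maxima: Eliashberg 1990,
§2; Cieliebak–Eliashberg 2012, §3.2 and Ch. 8) uses that strict `J`-convexity of `φ` at a point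
persists nearby and survives adding `ε ψ` for `|ε|` small, uniformly on compact sets.  In the
tree's formalism (`SteinDomain.lean`: Levi form `-dd^ℂφ_x(v, J_x v)` on the tangent spaces
trivialised chartwise, for a field `J` preserving smooth vector fields) this file proves:

* `eventually_forall_pos_of_homogeneous` — a continuous family of degree-`2` homogeneous
  functions on `ℝ⁴` which is positive off `0` at one parameter stays so for nearby parameters
  (compactness of the unit sphere);
* `snd_trivializationAt`, `tangentCoordChange_JTriv`, `levi_inChart_apply` — **the Levi form
  read in the chart at `x₀`**: for `x` in the chart domain and `u ∈ ℝ⁴`, with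
  `τ = tangentCoordChange x₀ x x` and `Ĵ_x = JTriv J x₀ x` (`SteinJBundle.lean`),
  `dd^ℂφ_x(τ u, J_x τ u) = (dd^ℂφ)^(c x)(u, Ĵ_x u)` where `(·)^` is the chart representative
  (`MForm.inChart`), continuous in `x` together with `Ĵ_x`;
* `isOpen_setOf_levi_pos` — **the set of `(x, ε) ∈ W × ℝ` at which `φ + ε ψ` is strictly
  `J`-convex at `x` is open** (`φ`, `ψ` smooth);
* `isOpen_setOf_levi_pos₀` — in particular strict `J`-convexity of `φ` is an open condition;
* `exists_levi_pos_perturb_of_isCompact` — **uniform stability on compact sets**: if `φ` is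
  strictly `J`-convex at every point of a compact `K`, there are an open `U ⊇ K` and `ε₀ > 0`
  with `φ + ε ψ` strictly `J`-convex on `U` for all `|ε| < ε₀` (generalized tube lemma).

Everything is **proved**; no definition, no named fact.

## References

* K. Cieliebak, Ya. Eliashberg, *From Stein to Weinstein and Back*, AMS Colloquium Publ. 59
  (2012), §2.1–§3.2 (`J`-convex functions; the condition is open). [CieliebakEliashberg2012]
* Ya. Eliashberg, *Topological characterization of Stein manifolds of dimension > 2*, Internat.
  J. Math. 1 (1990), §2. [Eliashberg1990Stein]
-/

noncomputable section

open scoped Manifold ContDiff Topology Bundle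
open Set Function Filter Bundle

namespace Literature.Geometry.Symplectic

open Literature.Geometry.Kaehler Literature.Analysis.ODE

/-! ### Positivity of homogeneous functions is an open condition in parameters -/

/-- **A continuous family of degree-`2` homogeneous functions positive off `0` stays positive
for nearby parameters.**  If `(x, u) ↦ f x u` is continuous at the points `(x₀, u)`, `‖u‖ = 1`,
`f x (t • u) = t² f x u`, and `f x₀ u > 0` for all `u ≠ 0`, then `f x u > 0` for all `u ≠ 0`
for `x` near `x₀` (compactness of the unit sphere of `ℝ⁴`). [folklore] -/
theorem eventually_forall_pos_of_homogeneous {X : Type*} [TopologicalSpace X]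
    {f : X → EuclideanSpace ℝ (Fin 4) → ℝ} {x₀ : X}
    (hcont : ∀ u ∈ Metric.sphere (0 : EuclideanSpace ℝ (Fin 4)) 1, ContinuousAt (uncurry f) (x₀, u))
    (hhom : ∀ x u (t : ℝ), f x (t • u) = t ^ 2 * f x u)
    (hpos : ∀ u, u ≠ 0 → 0 < f x₀ u) :
    ∀ᶠ x in 𝓝 x₀, ∀ u, u ≠ 0 → 0 < f x u := by
  have hK : IsCompact (Metric.sphere (0 : EuclideanSpace ℝ (Fin 4)) 1) := isCompact_sphere 0 1
  have h1 : ∀ u ∈ Metric.sphere (0 : EuclideanSpace ℝ (Fin 4)) 1,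
      ∀ᶠ z : X × EuclideanSpace ℝ (Fin 4) in 𝓝 (x₀, u), 0 < f z.1 z.2 := by
    intro u hu
    have hu0 : u ≠ 0 := by
      intro h; rw [h, mem_sphere_zero_iff_norm, norm_zero] at hu; exact zero_ne_one hu
    exact (hcont u hu).eventually (Ioi_mem_nhds (hpos u hu0))
  have h2 := hK.eventually_forall_of_forall_eventually (P := fun x u => 0 < f x u) h1
  filter_upwards [h2] with x hx u hu
  have hn : 0 < ‖u‖ := norm_pos_iff.2 hu
  have hmem : ‖u‖⁻¹ • u ∈ Metric.sphere (0 : EuclideanSpace ℝ (Fin 4)) 1 := by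
    rw [mem_sphere_zero_iff_norm, norm_smul, norm_inv, norm_norm, inv_mul_cancel₀ hn.ne']
  have h3 : 0 < f x (‖u‖⁻¹ • u) := hx _ hmem
  have h4 : f x u = ‖u‖ ^ 2 * f x (‖u‖⁻¹ • u) := by
    rw [← hhom, smul_smul, mul_inv_cancel₀ hn.ne', one_smul]
  rw [h4]
  positivity

/-! ### The Levi form read in a chart -/

section Chart

variable {W : Type*} [TopologicalSpace W] [ChartedSpace (EuclideanHalfSpace 4) W]
  [IsManifold (𝓡∂ 4) ∞ W]

/-- The fibre component of the tangent-bundle trivialization at `x₀` is the tangent coordinate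
change `τ_{x → x₀}`. [folklore] -/
theorem snd_trivializationAt (x₀ x : W) (v : EuclideanSpace ℝ (Fin 4)) :
    ((trivializationAt (EuclideanSpace ℝ (Fin 4)) (TangentSpace (𝓡∂ 4)) x₀)
        (⟨x, v⟩ : TangentBundle (𝓡∂ 4) W)).2 = tangentCoordChange (𝓡∂ 4) x x₀ x v :=
  rfl

/-- **`τ ∘ Ĵ_x = J_x ∘ τ`**: the matrix `Ĵ_x = JTriv J x₀ x` of `J` in the trivialization at
`x₀` is conjugate to `J_x` by `τ = tangentCoordChange x₀ x x`. [folklore] -/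
theorem tangentCoordChange_JTriv (J : (x : W) → (EuclideanSpace ℝ (Fin 4) →L[ℝ] EuclideanSpace ℝ (Fin 4)))
    {x₀ x : W} (hx : x ∈ (chartAt (EuclideanHalfSpace 4) x₀).source) (u : EuclideanSpace ℝ (Fin 4)) :
    tangentCoordChange (𝓡∂ 4) x₀ x x (JTriv J x₀ x u) =
      J x (tangentCoordChange (𝓡∂ 4) x₀ x x u) := by
  have hx' : x ∈ (extChartAt (𝓡∂ 4) x₀).source := by rwa [extChartAt_source]
  have hxx : x ∈ (extChartAt (𝓡∂ 4) x).source := mem_extChartAt_source x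
  -- `τ' (τ u) = u` and `τ (τ' w) = w` for `τ' = tangentCoordChange x x₀ x`
  have h1 : tangentCoordChange (𝓡∂ 4) x x₀ x (tangentCoordChange (𝓡∂ 4) x₀ x x u) = u := by
    rw [tangentCoordChange_comp ⟨⟨hx', hxx⟩, hx'⟩, tangentCoordChange_self hx']
  have h2 : ∀ w, tangentCoordChange (𝓡∂ 4) x₀ x x (tangentCoordChange (𝓡∂ 4) x x₀ x w) = w :=
    fun w => by rw [tangentCoordChange_comp ⟨⟨hxx, hx'⟩, hxx⟩, tangentCoordChange_self hxx]
  have h3 := trivializationAt_J_apply J hx (tangentCoordChange (𝓡∂ 4) x₀ x x u)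
  rw [snd_trivializationAt, snd_trivializationAt, h1] at h3
  -- `h3 : τ' (J x (τ u)) = JTriv J x₀ x u`
  rw [← h3, h2]

variable [T2Space W] {J : (x : W) → (EuclideanSpace ℝ (Fin 4) →L[ℝ] EuclideanSpace ℝ (Fin 4))}

omit [T2Space W] in
/-- **The Levi form read in the chart at `x₀`.**  For `x` in the chart domain of `x₀` and
`u ∈ ℝ⁴`, with `τ = tangentCoordChange x₀ x x`:
`dd^ℂφ_x(τ u, J_x (τ u)) = (dd^ℂφ)^(c x)(u, Ĵ_x u)`. [folklore] -/
theorem levi_inChart_apply (φ : W → ℝ) {x₀ x : W}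
    (hx : x ∈ (chartAt (EuclideanHalfSpace 4) x₀).source) (u : EuclideanSpace ℝ (Fin 4)) :
    (mextDeriv (dComplex J φ)).inChart x₀ (extChartAt (𝓡∂ 4) x₀ x) ![u, JTriv J x₀ x u] =
      mextDeriv (dComplex J φ) x ![tangentCoordChange (𝓡∂ 4) x₀ x x u,
        J x (tangentCoordChange (𝓡∂ 4) x₀ x x u)] := by
  rw [inChart_apply_extChartAt _ hx, ← tangentCoordChange_JTriv J hx]
  congr 1
  funext i
  fin_cases i <;> rfl

/-- The chart representative of `dd^ℂφ` at `x₀`, composed with the chart, is continuous at `x₀`.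
[folklore] -/
theorem continuousAt_inChart_levi_comp (hJ : PreservesSmoothFields J) {φ : W → ℝ}
    (hφ : ContMDiff (𝓡∂ 4) 𝓘(ℝ, ℝ) ∞ φ) (x₀ : W) :
    ContinuousAt (fun x => (mextDeriv (dComplex J φ)).inChart x₀ (extChartAt (𝓡∂ 4) x₀ x)) x₀ := by
  have hsm : IsSmoothForm (mextDeriv (dComplex J φ)) :=
    isSmoothForm_mextDeriv (inChart_mextDeriv_holds (𝓡∂ 4) W ℝ)
      (isSmoothForm_dComplex_of_preservesSmoothFields hJ hφ)
  have h1 : ContinuousWithinAt ((mextDeriv (dComplex J φ)).inChart x₀) (range (𝓡∂ 4))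
      (extChartAt (𝓡∂ 4) x₀ x₀) :=
    (MForm.SmoothAt.contDiffWithinAt_inChart (mem_extChartAt_source x₀) (hsm x₀)).continuousWithinAt
  have h2 : ContinuousWithinAt (extChartAt (𝓡∂ 4) x₀) univ x₀ :=
    (continuousAt_extChartAt x₀).continuousWithinAt
  have h3 := h1.comp h2 fun x _ => mem_range_self ((chartAt (EuclideanHalfSpace 4) x₀) x)
  exact (continuousWithinAt_univ _ _).1 h3

/-- `x ↦ Ĵ_x = JTriv J x₀ x` is continuous at `x₀` as an operator-valued map. [folklore] -/
theorem continuousAt_JTriv_clm (hJ : PreservesSmoothFields J) (x₀ : W) :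
    ContinuousAt (fun x => JTriv J x₀ x) x₀ :=
  continuousAt_clm_apply.2 fun w =>
    (contMDiffAt_JTriv hJ x₀ w (mem_chart_source _ x₀)).continuousAt

omit [T2Space W] in
/-- Degree-`2` homogeneity of `u ↦ Ω(u, L u)` for a `2`-form `Ω` and a linear `L`. [folklore] -/
theorem alt2_apply_smul_pair (Ω : EuclideanSpace ℝ (Fin 4) [⋀^Fin 2]→L[ℝ] ℝ)
    (L : EuclideanSpace ℝ (Fin 4) →L[ℝ] EuclideanSpace ℝ (Fin 4)) (u : EuclideanSpace ℝ (Fin 4))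
    (t : ℝ) : Ω ![t • u, L (t • u)] = t ^ 2 * Ω ![u, L u] := by
  rw [map_smul]
  have h1 : Ω ![t • u, t • L u] = t • Ω ![u, t • L u] := by
    rw [← update_pair_zero u (t • L u) (t • u), Ω.map_update_smul, update_pair_zero]
  have h2 : Ω ![u, t • L u] = t • Ω ![u, L u] := by
    rw [← update_pair_one u (L u) (t • L u), Ω.map_update_smul, update_pair_one]
  rw [h1, h2, smul_eq_mul, smul_eq_mul]
  ring

end Chart

/-! ### Openness of strict `J`-convexity -/

section Open

variable {W : Type*} [TopologicalSpace W] [T2Space W] [ChartedSpace (EuclideanHalfSpace 4) W]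
  [IsManifold (𝓡∂ 4) ∞ W] {J : (x : W) → (EuclideanSpace ℝ (Fin 4) →L[ℝ] EuclideanSpace ℝ (Fin 4))}

/-- The Levi form of `φ + ε ψ` is `Levi(φ) + ε Levi(ψ)`. [folklore] -/
theorem levi_add_const_mul (hJ : PreservesSmoothFields J) {φ ψ : W → ℝ}
    (hφ : ContMDiff (𝓡∂ 4) 𝓘(ℝ, ℝ) ∞ φ) (hψ : ContMDiff (𝓡∂ 4) 𝓘(ℝ, ℝ) ∞ ψ) (ε : ℝ) (x : W)
    (V : Fin 2 → EuclideanSpace ℝ (Fin 4)) :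
    -(mextDeriv (dComplex J (φ + fun y => ε * ψ y)) x V) =
      -(mextDeriv (dComplex J φ) x V) + ε * -(mextDeriv (dComplex J ψ) x V) := by
  have hεψ : ContMDiff (𝓡∂ 4) 𝓘(ℝ, ℝ) ∞ (fun y => ε * ψ y) := contMDiff_const.mul hψ
  rw [levi_add hJ hφ hεψ, levi_const_mul hψ]

/-- **Strict `J`-convexity of `φ + ε ψ` at `x` is an open condition in `(x, ε)`** (`J`
preserving smooth vector fields, `φ`, `ψ` smooth): the Levi form read in the chart at a point
is a continuous family of quadratic functions of the chart vector, positive off `0`.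
[cite: CieliebakEliashberg2012, §2] -/
theorem isOpen_setOf_levi_pos (hJ : PreservesSmoothFields J) {φ ψ : W → ℝ}
    (hφ : ContMDiff (𝓡∂ 4) 𝓘(ℝ, ℝ) ∞ φ) (hψ : ContMDiff (𝓡∂ 4) 𝓘(ℝ, ℝ) ∞ ψ) :
    IsOpen {p : W × ℝ | ∀ v : EuclideanSpace ℝ (Fin 4), v ≠ 0 →
      0 < -(mextDeriv (dComplex J (φ + fun y => p.2 * ψ y)) p.1 ![v, J p.1 v])} := by
  rw [isOpen_iff_mem_nhds]
  rintro ⟨x₁, ε₁⟩ hp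
  simp only [mem_setOf_eq] at hp
  -- the Levi forms of `φ`, `ψ` read in the chart at `x₁`
  set c := extChartAt (𝓡∂ 4) x₁ with hc
  set A : W → EuclideanSpace ℝ (Fin 4) [⋀^Fin 2]→L[ℝ] ℝ :=
    fun x => (mextDeriv (dComplex J φ)).inChart x₁ (c x) with hA
  set B : W → EuclideanSpace ℝ (Fin 4) [⋀^Fin 2]→L[ℝ] ℝ :=
    fun x => (mextDeriv (dComplex J ψ)).inChart x₁ (c x) with hB
  set Ĵ : W → EuclideanSpace ℝ (Fin 4) →L[ℝ] EuclideanSpace ℝ (Fin 4) := fun x => JTriv J x₁ x with hĴ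
  set f : W × ℝ → EuclideanSpace ℝ (Fin 4) → ℝ :=
    fun p u => -(A p.1 ![u, Ĵ p.1 u]) + p.2 * -(B p.1 ![u, Ĵ p.1 u]) with hf
  -- `f` computes the Levi form of `φ + ε ψ` at `x` on `τ u`
  have hfeq : ∀ p : W × ℝ, p.1 ∈ (chartAt (EuclideanHalfSpace 4) x₁).source → ∀ u,
      f p u = -(mextDeriv (dComplex J (φ + fun y => p.2 * ψ y)) p.1
        ![tangentCoordChange (𝓡∂ 4) x₁ p.1 p.1 u,
          J p.1 (tangentCoordChange (𝓡∂ 4) x₁ p.1 p.1 u)]) := by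
    rintro ⟨x, ε⟩ hx u
    rw [levi_add_const_mul hJ hφ hψ]
    simp only [hf, hA, hB, hĴ]
    rw [levi_inChart_apply φ hx u, levi_inChart_apply ψ hx u]
  -- continuity of `f` at the points `((x₁, ε₁), u)`
  have hA0 : ContinuousAt A x₁ := continuousAt_inChart_levi_comp hJ hφ x₁
  have hB0 : ContinuousAt B x₁ := continuousAt_inChart_levi_comp hJ hψ x₁
  have hĴ0 : ContinuousAt Ĵ x₁ := continuousAt_JTriv_clm hJ x₁
  have hcont : ∀ u₀ : EuclideanSpace ℝ (Fin 4), ContinuousAt (uncurry f) ((x₁, ε₁), u₀) := by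
    intro u₀
    have hAc : ContinuousAt (fun z : (W × ℝ) × EuclideanSpace ℝ (Fin 4) => A z.1.1) ((x₁, ε₁), u₀) :=
      hA0.fst'.fst'
    have hBc : ContinuousAt (fun z : (W × ℝ) × EuclideanSpace ℝ (Fin 4) => B z.1.1) ((x₁, ε₁), u₀) :=
      hB0.fst'.fst'
    have hĴc' : ContinuousAt (fun z : (W × ℝ) × EuclideanSpace ℝ (Fin 4) => Ĵ z.1.1) ((x₁, ε₁), u₀) :=
      hĴ0.fst'.fst'
    have hĴc : ContinuousAt (fun z : (W × ℝ) × EuclideanSpace ℝ (Fin 4) => Ĵ z.1.1 z.2)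
        ((x₁, ε₁), u₀) := hĴc'.clm_apply continuousAt_snd
    have hV : ContinuousAt (fun z : (W × ℝ) × EuclideanSpace ℝ (Fin 4) =>
        (![z.2, Ĵ z.1.1 z.2] : Fin 2 → EuclideanSpace ℝ (Fin 4))) ((x₁, ε₁), u₀) := by
      refine continuousAt_pi.2 fun i => ?_
      fin_cases i
      · exact continuousAt_snd
      · exact hĴc
    have hε : ContinuousAt (fun z : (W × ℝ) × EuclideanSpace ℝ (Fin 4) => z.1.2) ((x₁, ε₁), u₀) :=
      continuousAt_snd.fst'
    have h1 := hAc.eval hV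
    have h2 := hBc.eval hV
    exact h1.neg.add (hε.mul h2.neg)
  -- homogeneity and positivity at the base point
  have hhom : ∀ p u (t : ℝ), f p (t • u) = t ^ 2 * f p u := by
    intro p u t
    simp only [hf]
    rw [alt2_apply_smul_pair, alt2_apply_smul_pair]
    ring
  have hx₁ : x₁ ∈ (chartAt (EuclideanHalfSpace 4) x₁).source := mem_chart_source _ x₁
  have hx₁' : x₁ ∈ (extChartAt (𝓡∂ 4) x₁).source := mem_extChartAt_source x₁
  have hpos : ∀ u, u ≠ 0 → 0 < f (x₁, ε₁) u := by
    intro u hu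
    rw [hfeq (x₁, ε₁) hx₁ u, tangentCoordChange_self hx₁']
    exact hp u hu
  -- conclude
  have hev := eventually_forall_pos_of_homogeneous (fun u _ => hcont u) hhom hpos
  have hsrc : ∀ᶠ p : W × ℝ in 𝓝 (x₁, ε₁), p.1 ∈ (chartAt (EuclideanHalfSpace 4) x₁).source :=
    continuousAt_fst.preimage_mem_nhds ((chartAt _ x₁).open_source.mem_nhds hx₁)
  filter_upwards [hev, hsrc] with p hp' hps
  intro v hv
  have hps' : p.1 ∈ (extChartAt (𝓡∂ 4) x₁).source := by rwa [extChartAt_source]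
  have hpp : p.1 ∈ (extChartAt (𝓡∂ 4) p.1).source := mem_extChartAt_source p.1
  -- `v = τ u` with `u = τ' v`
  set u := tangentCoordChange (𝓡∂ 4) p.1 x₁ p.1 v with hu
  have hτu : tangentCoordChange (𝓡∂ 4) x₁ p.1 p.1 u = v := by
    rw [hu, tangentCoordChange_comp ⟨⟨hpp, hps'⟩, hpp⟩, tangentCoordChange_self hpp]
  have hu0 : u ≠ 0 := by
    intro h0
    apply hv
    rw [← hτu, h0, map_zero]
  have key := hp' u hu0
  rwa [hfeq p hps u, hτu] at key

/-- **Strict `J`-convexity is an open condition**: the set of points at which a smooth `φ` is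
strictly `J`-convex is open. [cite: CieliebakEliashberg2012, §2] -/
theorem isOpen_setOf_levi_pos₀ (hJ : PreservesSmoothFields J) {φ : W → ℝ}
    (hφ : ContMDiff (𝓡∂ 4) 𝓘(ℝ, ℝ) ∞ φ) :
    IsOpen {x : W | ∀ v : EuclideanSpace ℝ (Fin 4), v ≠ 0 →
      0 < -(mextDeriv (dComplex J φ) x ![v, J x v])} := by
  have h := (isOpen_setOf_levi_pos hJ hφ hφ).preimage (Continuous.prodMk_left (0 : ℝ))
  have hφ0 : (φ + fun y => (0 : ℝ) * φ y) = φ := by funext y; simp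
  convert h using 1
  ext x
  simp only [mem_setOf_eq, mem_preimage, hφ0]

/-- **Uniform stability of strict `J`-convexity under small perturbations on compact sets.**
If the smooth `φ` is strictly `J`-convex at every point of a compact `K` and `ψ` is smooth,
there are an open `U ⊇ K` and `ε₀ > 0` such that `φ + ε ψ` is strictly `J`-convex at every
point of `U` for all `|ε| < ε₀`. [cite: CieliebakEliashberg2012, §3.2] -/
theorem exists_levi_pos_perturb_of_isCompact (hJ : PreservesSmoothFields J) {φ ψ : W → ℝ}
    (hφ : ContMDiff (𝓡∂ 4) 𝓘(ℝ, ℝ) ∞ φ) (hψ : ContMDiff (𝓡∂ 4) 𝓘(ℝ, ℝ) ∞ ψ) {K : Set W}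
    (hK : IsCompact K)
    (hpos : ∀ x ∈ K, ∀ v : EuclideanSpace ℝ (Fin 4), v ≠ 0 →
      0 < -(mextDeriv (dComplex J φ) x ![v, J x v])) :
    ∃ U : Set W, IsOpen U ∧ K ⊆ U ∧ ∃ ε₀ : ℝ, 0 < ε₀ ∧ ∀ ε : ℝ, |ε| < ε₀ → ∀ x ∈ U,
      ∀ v : EuclideanSpace ℝ (Fin 4), v ≠ 0 →
        0 < -(mextDeriv (dComplex J (φ + fun y => ε * ψ y)) x ![v, J x v]) := by
  set G := {p : W × ℝ | ∀ v : EuclideanSpace ℝ (Fin 4), v ≠ 0 →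
      0 < -(mextDeriv (dComplex J (φ + fun y => p.2 * ψ y)) p.1 ![v, J p.1 v])} with hG
  have hGo : IsOpen G := isOpen_setOf_levi_pos hJ hφ hψ
  have hsub : K ×ˢ ({0} : Set ℝ) ⊆ G := by
    rintro ⟨x, ε⟩ ⟨hx, hε⟩
    rw [mem_singleton_iff] at hε
    subst hε
    simp only [hG, mem_setOf_eq]
    intro v hv
    rw [levi_add_const_mul hJ hφ hψ, zero_mul, add_zero]
    exact hpos x hx v hv
  obtain ⟨U, V, hU, hV, hKU, h0V, hUV⟩ := generalized_tube_lemma hK isCompact_singleton hGo hsub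
  have h0 : (0 : ℝ) ∈ V := h0V rfl
  obtain ⟨ε₀, hε₀, hball⟩ := Metric.isOpen_iff.1 hV 0 h0
  refine ⟨U, hU, hKU, ε₀, hε₀, fun ε hε x hx => ?_⟩
  have hεV : ε ∈ V := hball (by rw [Metric.mem_ball, dist_zero_right]; exact hε)
  have hmem : (x, ε) ∈ G := hUV ⟨hx, hεV⟩
  exact hmem

end Open

end Literature.Geometry.Symplectic

end
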